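import Literature.NumberTheory.LFunctions.RayClassLFunctionExceptionalZeroSimple
import Literature.NumberTheory.LFunctions.RayClassLogFreeSieveSide
import Literature.NumberTheory.LFunctions.DedekindZetaZeroFreeRegionUniform
import HarnessLib

/-!
# Thorner–Zaman's Theorem 3.1 for a congruence class group `mod 𝔪`: the exceptional zero (real, unique, simple),
# uniformly in the field and the modulus

Topic `Literature/NumberTheory/LFunctions`, namespace `Literature.NumberTheory.LFunctions.AbelianDensity`.
Everything here is PROVED (theorems only; no named facts).

The ray-class counterpart of `ClassGroupLFunctionExceptionalZero.exists_exceptionalZero_const` (conductor `1`).  For an abelian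
Frobenius datum `f : 𝔭 ↦ f 𝔭 ∈ G` killing the narrow ray `mod 𝔪 ≠ 0` whose non-trivial characters are non-principal on the primes
`∤ 𝔪` (the characters of a congruence class group `H ⊇ P^𝔪`; `∏_ψ L(s, ψ)` is the Dedekind zeta function of the class field of
`H`, not used), write "`ρ` is a zero of the factor `ψ`" for `L_ψ(ρ) = 0` (`datumL`, the entire Hecke `L`-function of the primitive
associate of `ψ ∘ f`) if `ψ ≠ 0` and `ζ₁_K(ρ) = 0` (`ζ₁_K = (s−1)ζ_K`) if `ψ = 0`.  With `ℒ(t) = log(|d_K| N𝔪) + log(|t| + 4)` and a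
constant `c = c(n) > 0` depending on the DEGREE alone:
* `exists_exceptionalZero_congruence_const (n)` — every such zero with `Re ρ > 1 − c/ℒ(Im ρ)` is REAL and its character is
  REAL (`ψ + ψ = 0`); two such zeros `(ψ₁, ρ₁)`, `(ψ₂, ρ₂)` coincide; and the zero is SIMPLE.
[ThornerZaman2019, Theorem 3.1] for `L =` the class field of `H` (`Q = D_K 𝒬 = |d_K| N𝔪`-type dependence absorbed into `c(n)`).

## References
* [ThornerZaman2019] J. Thorner, A. Zaman, Algebra & Number Theory 13 (2019), Theorem 3.1.
* [MontgomeryVaughan2007] H. L. Montgomery, R. C. Vaughan, *Multiplicative Number Theory I*, §11.1–11.2.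
-/

noncomputable section

open scoped NumberField nonZeroDivisors
open Complex Filter Topology Set Metric NumberField IsDedekindDomain Finset

namespace Literature.NumberTheory.LFunctions.AbelianDensity

open Literature.NumberTheory.LFunctions.NumberField Literature.NumberTheory.LFunctions.LogFreeLocal
open scoped Classical

/-- `(ψ₁ + ψ₂) ∘ f = (ψ₁ ∘ f)(ψ₂ ∘ f)` pointwise. [cite: ThornerZaman2019, Theorem 3.1] -/
theorem charFun_add {K : Type*} [Field K] {G : Type*} [CommGroup G] (f : HeightOneSpectrum (𝓞 K) → G)
    (ψ₁ ψ₂ : AddChar (Additive G) ℂ) (v : HeightOneSpectrum (𝓞 K)) :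
    charFun f (ψ₁ + ψ₂) v = charFun f ψ₁ v * charFun f ψ₂ v := by
  simp [charFun, toMulHom_apply, AddChar.add_apply]

/-- A character whose square is principal off `𝔪` is real: `ψ + ψ = 0`. [cite: ThornerZaman2019, Theorem 3.1] -/
theorem add_self_eq_zero_of_sq {K : Type*} [Field K] {G : Type*} [CommGroup G] {𝔪 : Ideal (𝓞 K)}
    {f : HeightOneSpectrum (𝓞 K) → G}
    (hsep : ∀ χ : AddChar (Additive G) ℂ, χ ≠ 0 →
      ∃ v : HeightOneSpectrum (𝓞 K), ¬ 𝔪 ≤ v.asIdeal ∧ χ (Additive.ofMul (f v)) ≠ 1)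
    {ψ : AddChar (Additive G) ℂ} (h2 : ∀ v : HeightOneSpectrum (𝓞 K), ¬ 𝔪 ≤ v.asIdeal → charFun f ψ v ^ 2 = 1) :
    ψ + ψ = 0 := by
  by_contra hne
  obtain ⟨v, hv, hv1⟩ := hsep (ψ + ψ) hne
  apply hv1
  have := h2 v hv
  rw [sq, ← charFun_add] at this
  simpa [charFun, toMulHom_apply] using this

/-- **Thorner–Zaman's Theorem 3.1 for a congruence class group `mod 𝔪`, uniformly in the field and the modulus**: for every
`n` there is `c = c(n) > 0` such that for every number field `K` of degree `n`, every abelian Frobenius datum `f` killing the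
narrow ray `mod 𝔪 ≠ 0` with non-trivial characters non-principal off `𝔪`, writing
`Z ψ ρ :↔ (ψ = 0 → ζ₁_K(ρ) = 0) ∧ (ψ ≠ 0 → L_ψ(ρ) = 0) ∧ Re ρ > 1 − c/(log(|d_K|N𝔪) + log(|Im ρ| + 4))`:
(1) `Z ψ ρ → Im ρ = 0 ∧ ψ + ψ = 0`; (2) `Z ψ₁ ρ₁ → Z ψ₂ ρ₂ → ψ₁ = ψ₂ ∧ ρ₁ = ρ₂`; (3) `Z ψ ρ →` the zero is simple.
[cite: ThornerZaman2019, Theorem 3.1] -/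
theorem exists_exceptionalZero_congruence_const (n : ℕ) :
    ∃ c : ℝ, 0 < c ∧ ∀ (K : Type) [Field K] [NumberField K], Module.finrank ℚ K = n →
      ∀ (G : Type) [CommGroup G] [Finite G] (𝔪 : Ideal (𝓞 K)) (f : HeightOneSpectrum (𝓞 K) → G)
        (h𝔪 : 𝔪 ≠ ⊥) (hray : ArtinKillsRay 𝔪 f)
        (hsep : ∀ χ : AddChar (Additive G) ℂ, χ ≠ 0 →
          ∃ v : HeightOneSpectrum (𝓞 K), ¬ 𝔪 ≤ v.asIdeal ∧ χ (Additive.ofMul (f v)) ≠ 1),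
      let Z : AddChar (Additive G) ℂ → ℂ → Prop := fun ψ ρ ↦
        ((ψ = 0 → dedekindZeta₁ K ρ = 0) ∧ (ψ ≠ 0 → datumL h𝔪 hray hsep ψ ρ = 0)) ∧
          1 - c / (Real.log (((discr K).natAbs : ℝ) * ((Ideal.absNorm 𝔪 : ℕ) : ℝ)) + Real.log (|ρ.im| + 4)) < ρ.re
      (∀ ψ ρ, Z ψ ρ → ρ.im = 0 ∧ ψ + ψ = 0) ∧
      (∀ ψ₁ ψ₂ ρ₁ ρ₂, Z ψ₁ ρ₁ → Z ψ₂ ρ₂ → ψ₁ = ψ₂ ∧ ρ₁ = ρ₂) ∧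
      (∀ ψ ρ, Z ψ ρ → (ψ = 0 → analyticOrderAt (dedekindZeta₁ K) ρ = 1) ∧
        (∀ hψ : ψ ≠ 0, analyticOrderAt (datumData h𝔪 hray hsep ψ hψ).L ρ = 1)) := by
  obtain ⟨c₁, hc₁, hZF⟩ := exists_zeroFree_rayClass_absolute
  obtain ⟨c₂, hc₂, hZFζ⟩ := exists_zeroFree_dedekindZeta₁ n
  obtain ⟨c₃, hc₃, hmin⟩ := exists_min_realZeros_rayClass_le n
  obtain ⟨c₄, hc₄, hlan⟩ := exists_landau_rayClass n
  obtain ⟨c₅, hc₅, hminζ⟩ := exists_min_realZeros_dedekindZeta₁_le n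
  obtain ⟨c₆, hc₆, hlanζ⟩ := exists_landau_dedekindZeta₁_rayClass n
  obtain ⟨c₇, hc₇, hsim⟩ := exists_realZero_simple_rayClass n
  obtain ⟨c₈, hc₈, hsimζ⟩ := exists_realZero_simple_dedekindZeta₁ n
  -- the absolute ZFR constant is divided by `5n + 2` (`modDiscBound ≤ (5n+2) ℒ`)
  set c₁' : ℝ := c₁ / (5 * n + 2) with hc₁'
  have hc₁'pos : 0 < c₁' := by positivity
  set c : ℝ := min (min (min c₁' c₂) (min c₃ c₄)) (min (min c₅ c₆) (min c₇ c₈)) with hcdef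
  have hc : 0 < c := by positivity
  have h1 : c ≤ c₁' := by simp [hcdef]
  have h2 : c ≤ c₂ := by simp [hcdef]
  have h3 : c ≤ c₃ := by simp [hcdef]
  have h4 : c ≤ c₄ := by simp [hcdef]
  have h5 : c ≤ c₅ := by simp [hcdef]
  have h6 : c ≤ c₆ := by simp [hcdef]
  have h7 : c ≤ c₇ := by simp [hcdef]
  have h8 : c ≤ c₈ := by simp [hcdef]
  refine ⟨c, hc, fun K _ _ hK G _ _ 𝔪 f h𝔪 hray hsep ↦ ?_⟩
  intro Z
  have hnK : Module.finrank ℚ K ≤ n := hK.le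
  set Q : ℝ := ((discr K).natAbs : ℝ) * ((Ideal.absNorm 𝔪 : ℕ) : ℝ) with hQ
  have hQ1 : 1 ≤ Q := one_le_discr_mul_absNorm K h𝔪
  have hd1 : (1 : ℝ) ≤ ((discr K).natAbs : ℝ) := by exact_mod_cast Int.natAbs_pos.mpr (discr_ne_zero K)
  have hd0 : (0 : ℝ) < ((discr K).natAbs : ℝ) := by linarith
  have hm1 : (1 : ℝ) ≤ ((Ideal.absNorm 𝔪 : ℕ) : ℝ) := by
    exact_mod_cast Nat.one_le_iff_ne_zero.mpr (by rw [Ne, Ideal.absNorm_eq_zero_iff]; exact h𝔪)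
  have hlogdQ : Real.log ((discr K).natAbs : ℝ) ≤ Real.log Q := Real.log_le_log hd0 (by rw [hQ]; nlinarith)
  have hℒpos : ∀ t : ℝ, 0 < Real.log Q + Real.log (|t| + 4) := fun t ↦ TwistedZFR.ell_pos hQ1 t
  have hℒpos' : ∀ t : ℝ, 0 < Real.log ((discr K).natAbs : ℝ) + Real.log (|t| + 4) := fun t ↦ TwistedZFR.ell_pos hd1 t
  -- comparison of regions
  have hreg : ∀ {c' : ℝ} (ρ : ℂ), c ≤ c' → 1 - c / (Real.log Q + Real.log (|ρ.im| + 4)) < ρ.re →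
      1 - c' / (Real.log Q + Real.log (|ρ.im| + 4)) < ρ.re := by
    intro c' ρ hcc' h
    have := div_le_div_of_nonneg_right hcc' (hℒpos ρ.im).le
    linarith
  -- … and against the smaller `log|d_K|` size (for `ζ_K`)
  have hregd : ∀ {c' : ℝ} (ρ : ℂ), c ≤ c' → 0 ≤ c' → 1 - c / (Real.log Q + Real.log (|ρ.im| + 4)) < ρ.re →
      1 - c' / (Real.log ((discr K).natAbs : ℝ) + Real.log (|ρ.im| + 4)) < ρ.re := by
    intro c' ρ hcc' hc'0 h
    have h' := hreg ρ hcc' h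
    have := div_le_div_of_nonneg_left hc'0 (hℒpos' ρ.im) (by linarith : Real.log ((discr K).natAbs : ℝ) +
      Real.log (|ρ.im| + 4) ≤ Real.log Q + Real.log (|ρ.im| + 4))
    linarith
  have hreg0 : ∀ {c' : ℝ} (ρ : ℂ), c ≤ c' → ρ.im = 0 → 1 - c / (Real.log Q + Real.log (|ρ.im| + 4)) < ρ.re →
      1 - c' / (Real.log Q + Real.log 4) < ρ.re := by
    intro c' ρ hcc' him h
    have h' := hreg ρ hcc' h
    rwa [him, abs_zero, zero_add] at h'
  have hreg0d : ∀ {c' : ℝ} (ρ : ℂ), c ≤ c' → 0 ≤ c' → ρ.im = 0 → 1 - c / (Real.log Q + Real.log (|ρ.im| + 4)) < ρ.re →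
      1 - c' / (Real.log ((discr K).natAbs : ℝ) + Real.log 4) < ρ.re := by
    intro c' ρ hcc' hc'0 him h
    have h' := hregd ρ hcc' hc'0 h
    rwa [him, abs_zero, zero_add] at h'
  -- (1) reality
  have hreal : ∀ ψ ρ, Z ψ ρ → ρ.im = 0 ∧ ψ + ψ = 0 := by
    rintro ψ ρ ⟨⟨hz1, hz2⟩, hregion⟩
    by_cases hψ : ψ = 0
    · refine ⟨hZFζ K hK ρ (hz1 hψ) (hregd ρ h2 hc₂.le hregion), ?_⟩
      rw [hψ, add_zero]
    · have hz := hz2 hψ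
      rw [datumL_eq h𝔪 hray hsep hψ] at hz
      set D := datumData h𝔪 hray hsep ψ hψ
      -- the absolute region contains ours
      have hregion' : 1 - c₁ / modDiscBound K 𝔪 ρ.im < ρ.re := by
        have hr := hreg ρ h1 hregion
        have hM := modDiscBound_le (K := K) h𝔪 ρ.im
        have hMpos : 0 < modDiscBound K 𝔪 ρ.im := by
          have := one_le_modDiscBound (K := K) 𝔪 ρ.im; linarith
        have hn52 : (0 : ℝ) < 5 * n + 2 := by positivity
        have : c₁ / modDiscBound K 𝔪 ρ.im ≥ c₁' / (Real.log Q + Real.log (|ρ.im| + 4)) := by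
          rw [hc₁', ge_iff_le, div_div, div_le_div_iff₀ (mul_pos hn52 (hℒpos ρ.im)) hMpos]
          calc c₁ * modDiscBound K 𝔪 ρ.im ≤ c₁ * ((5 * Module.finrank ℚ K + 2) * (Real.log Q + Real.log (|ρ.im| + 4))) :=
                mul_le_mul_of_nonneg_left hM hc₁.le
            _ = c₁ * ((5 * n + 2) * (Real.log Q + Real.log (|ρ.im| + 4))) := by rw [hK]
        linarith
      have h := hZF K 𝔪 (charFun f ψ) (isRayClassCharacter_toMulHom hray ψ) (hsep ψ hψ) D ρ hz hregion'
      exact ⟨h.2, add_self_eq_zero_of_sq hsep h.1⟩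
  refine ⟨hreal, ?_, ?_⟩
  · -- (2) uniqueness
    intro ψ₁ ψ₂ ρ₁ ρ₂ hZ₁ hZ₂
    obtain ⟨him₁, hsq₁⟩ := hreal ψ₁ ρ₁ hZ₁
    obtain ⟨him₂, hsq₂⟩ := hreal ψ₂ ρ₂ hZ₂
    obtain ⟨⟨hz₁1, hz₁2⟩, hregion₁⟩ := hZ₁
    obtain ⟨⟨hz₂1, hz₂2⟩, hregion₂⟩ := hZ₂
    have hρ₁ : ρ₁ = (ρ₁.re : ℂ) := by apply Complex.ext <;> simp [him₁]
    have hρ₂ : ρ₂ = (ρ₂.re : ℂ) := by apply Complex.ext <;> simp [him₂]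
    have hcontra : ∀ {c' : ℝ}, c ≤ c' → ¬ min ρ₁.re ρ₂.re ≤ 1 - c' / (Real.log Q + Real.log 4) := by
      intro c' hcc' hle
      have h₁ := hreg0 ρ₁ hcc' him₁ hregion₁
      have h₂ := hreg0 ρ₂ hcc' him₂ hregion₂
      have : 1 - c' / (Real.log Q + Real.log 4) < min ρ₁.re ρ₂.re := lt_min h₁ h₂
      linarith
    have hcontrad : ∀ {c' : ℝ}, c ≤ c' → 0 ≤ c' →
        ¬ min ρ₁.re ρ₂.re ≤ 1 - c' / (Real.log ((discr K).natAbs : ℝ) + Real.log 4) := by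
      intro c' hcc' hc'0 hle
      have h₁ := hreg0d ρ₁ hcc' hc'0 him₁ hregion₁
      have h₂ := hreg0d ρ₂ hcc' hc'0 him₂ hregion₂
      have : 1 - c' / (Real.log ((discr K).natAbs : ℝ) + Real.log 4) < min ρ₁.re ρ₂.re := lt_min h₁ h₂
      linarith
    -- squares principal off `𝔪`
    have hsqf : ∀ {ψ : AddChar (Additive G) ℂ}, ψ + ψ = 0 →
        ∀ v : HeightOneSpectrum (𝓞 K), ¬ 𝔪 ≤ v.asIdeal → charFun f ψ v ^ 2 = 1 := by
      intro ψ h v _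
      rw [sq, ← charFun_add, h]; simp [charFun, toMulHom_apply]
    by_cases hψ₁ : ψ₁ = 0 <;> by_cases hψ₂ : ψ₂ = 0
    · refine ⟨hψ₁.trans hψ₂.symm, ?_⟩
      by_contra hne
      have hne' : ρ₁.re ≠ ρ₂.re := fun h ↦ hne (by rw [hρ₁, hρ₂, h])
      have hz₁ : dedekindZeta₁ K ρ₁.re = 0 := by rw [← hρ₁]; exact hz₁1 hψ₁
      have hz₂ : dedekindZeta₁ K ρ₂.re = 0 := by rw [← hρ₂]; exact hz₂1 hψ₂
      exact hcontrad h5 hc₅.le (hminζ K hK ρ₁.re ρ₂.re hne' hz₁ hz₂)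
    · exfalso
      have hz₁ : dedekindZeta₁ K ρ₁.re = 0 := by rw [← hρ₁]; exact hz₁1 hψ₁
      have hz₂ : (datumData h𝔪 hray hsep ψ₂ hψ₂).L ρ₂.re = 0 := by
        rw [← hρ₂, ← datumL_eq h𝔪 hray hsep hψ₂]; exact hz₂2 hψ₂
      exact hcontra h6 (hlanζ K hnK 𝔪 (charFun f ψ₂) (isRayClassCharacter_toMulHom hray ψ₂) (hsep ψ₂ hψ₂)
        _ ρ₁.re ρ₂.re hz₁ hz₂)
    · exfalso
      have hz₂ : dedekindZeta₁ K ρ₂.re = 0 := by rw [← hρ₂]; exact hz₂1 hψ₂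
      have hz₁ : (datumData h𝔪 hray hsep ψ₁ hψ₁).L ρ₁.re = 0 := by
        rw [← hρ₁, ← datumL_eq h𝔪 hray hsep hψ₁]; exact hz₁2 hψ₁
      have := hlanζ K hnK 𝔪 (charFun f ψ₁) (isRayClassCharacter_toMulHom hray ψ₁) (hsep ψ₁ hψ₁) _ ρ₂.re ρ₁.re hz₂ hz₁
      rw [min_comm] at this
      exact hcontra h6 this
    · have hz₁ : (datumData h𝔪 hray hsep ψ₁ hψ₁).L ρ₁.re = 0 := by
        rw [← hρ₁, ← datumL_eq h𝔪 hray hsep hψ₁]; exact hz₁2 hψ₁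
      have hz₂ : (datumData h𝔪 hray hsep ψ₂ hψ₂).L ρ₂.re = 0 := by
        rw [← hρ₂, ← datumL_eq h𝔪 hray hsep hψ₂]; exact hz₂2 hψ₂
      by_cases hψ : ψ₁ = ψ₂
      · refine ⟨hψ, ?_⟩
        subst hψ
        by_contra hne
        have hne' : ρ₁.re ≠ ρ₂.re := fun h ↦ hne (by rw [hρ₁, hρ₂, h])
        exact hcontra h3 (hmin K hnK 𝔪 (charFun f ψ₁) (isRayClassCharacter_toMulHom hray ψ₁) (hsep ψ₁ hψ₁)
          _ ρ₁.re ρ₂.re hne' hz₁ hz₂)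
      · exfalso
        -- `ψ₁ψ₂` is non-principal off `𝔪`: `ψ₁ + ψ₂ ≠ 0` since `ψ₂ = -ψ₂`
        have hne12 : ψ₁ + ψ₂ ≠ 0 := by
          intro h
          apply hψ
          have e2 : ψ₂ = -ψ₂ := by
            have := hsq₂; rwa [← eq_neg_iff_add_eq_zero] at this
          have e1 : ψ₁ = -ψ₂ := eq_neg_iff_add_eq_zero.mpr h
          rw [e1, ← e2]
        obtain ⟨v, hv, hv1⟩ := hsep (ψ₁ + ψ₂) hne12
        have h12 : ∃ v : HeightOneSpectrum (𝓞 K), ¬ 𝔪 ≤ v.asIdeal ∧ charFun f ψ₁ v * charFun f ψ₂ v ≠ 1 :=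
          ⟨v, hv, by rw [← charFun_add]; simpa [charFun, toMulHom_apply] using hv1⟩
        exact hcontra h4 (hlan K hnK 𝔪 (charFun f ψ₁) (charFun f ψ₂) (isRayClassCharacter_toMulHom hray ψ₁)
          (isRayClassCharacter_toMulHom hray ψ₂) (hsep ψ₁ hψ₁) (hsep ψ₂ hψ₂) (hsqf hsq₁) (hsqf hsq₂) h12 _ _
          ρ₁.re ρ₂.re hz₁ hz₂)
  · -- (3) simplicity
    intro ψ ρ hZ
    obtain ⟨him, -⟩ := hreal ψ ρ hZ
    obtain ⟨⟨hz1, hz2⟩, hregion⟩ := hZ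
    have hρ : ρ = (ρ.re : ℂ) := by apply Complex.ext <;> simp [him]
    have hwin : ∀ {c' : ℝ}, c ≤ c' → ¬ ρ.re ≤ 1 - c' / (Real.log Q + Real.log 4) := by
      intro c' hcc' hle
      have := hreg0 ρ hcc' him hregion
      linarith
    have hwind : ∀ {c' : ℝ}, c ≤ c' → 0 ≤ c' → ¬ ρ.re ≤ 1 - c' / (Real.log ((discr K).natAbs : ℝ) + Real.log 4) := by
      intro c' hcc' hc'0 hle
      have := hreg0d ρ hcc' hc'0 him hregion
      linarith
    have hord : ∀ {g : ℂ → ℂ}, Differentiable ℂ g → g ρ = 0 →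
        (¬ (2 : ℕ∞) ≤ analyticOrderAt g ρ) → analyticOrderAt g ρ ≠ ⊤ → analyticOrderAt g ρ = 1 := by
      intro g hg hz h2 htop
      have hne0 : analyticOrderAt g ρ ≠ 0 := by
        rw [ne_eq, (hg.analyticAt ρ).analyticOrderAt_eq_zero, not_not]; exact hz
      obtain ⟨k, hk⟩ := ENat.ne_top_iff_exists.mp htop
      rw [← hk] at hne0 h2 ⊢
      have h2' : ¬ 2 ≤ k := fun h ↦ h2 (by exact_mod_cast h)
      have h0' : k ≠ 0 := fun h ↦ hne0 (by rw [h]; rfl)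
      have : k = 1 := by omega
      rw [this]; rfl
    constructor
    · intro hψ
      have hz := hz1 hψ
      refine hord (dedekindZeta₁_differentiable K) hz (fun h2' ↦ ?_) (analyticOrderAt_dedekindZeta₁_ne_top ρ)
      have h2'' : (2 : ℕ∞) ≤ analyticOrderAt (dedekindZeta₁ K) (ρ.re : ℂ) := by rw [← hρ]; exact h2'
      exact hwind h8 hc₈.le (hsimζ K hK ρ.re h2'')
    · intro hψ
      set D := datumData h𝔪 hray hsep ψ hψ
      have hz : D.L ρ = 0 := by rw [← datumL_eq h𝔪 hray hsep hψ]; exact hz2 hψ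
      have hnt := hsep ψ hψ
      refine hord D.differentiable hz (fun h2' ↦ ?_) (analyticOrderAt_ne_top D.differentiable (D.L_two_add_ne_zero hnt 0) ρ)
      have h2'' : (2 : ℕ∞) ≤ analyticOrderAt D.L (ρ.re : ℂ) := by rw [← hρ]; exact h2'
      have hz' : D.L (ρ.re : ℂ) = 0 := by rw [← hρ]; exact hz
      exact hwin h7 (hsim K hnK 𝔪 (charFun f ψ) hnt D ρ.re hz' h2'')

end Literature.NumberTheory.LFunctions.AbelianDensity

end
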